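import Literature.AlgebraicGeometry.Frobenioids.FinSubextCatGaloisCorrespondence
import Literature.AlgebraicGeometry.Frobenioids.ArithmeticFrobenioidHypotheses
import Literature.AlgebraicGeometry.Frobenioids.EquivalenceTransport
import Literature.AlgebraicGeometry.Frobenioids.ModelFrobenioidRationalFunctionsProofs
import Literature.IUT.HodgeTheaters.GlobalFrobenioidsModelFrobenioid
import HarnessLib

/-!
# [IUTchI] Example 5.1 (ii): the divisor data `(Φ^⊛, 𝔹, Div)` on `†𝒟^⊛ = ℬ(G_F)⁰` AT THE ARITHMETIC MODEL
# ([FrdI] Example 6.3), and `ℱ^⊛(†𝒟^⊚)` IS a Frobenioid — the [FrdI] Thm 5.2 hypotheses DISCHARGED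

Mochizuki, *Inter-universal Teichmüller theory I*, §5, Example 5.1 (ii), kurims manuscript (May 2020) p. 125
([IUTchI] Ex 5.1 (ii) p.125) [claim: Mochizuki2012, status: disputed]: "by considering arithmetic divisors on
the stack-theoretic quotients of the spectra of the rings of integers of the number fields `𝕄̄^⊛(†𝒟^⊚)^A`
[for `A ∈ Ob(†𝒟^⊛)`], we obtain the monoid on `†𝒟^⊛`  `Φ^⊛(†𝒟^⊚)(−)`  [cf. [FrdI], Definition 1.1, (ii);
[FrdI], Example 6.3 …] … together with the natural morphism `𝕄^⊛(†𝒟^⊚)^A → Φ^⊛(†𝒟^⊚)(A)^gp` … this data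
determines, by applying [FrdI], Theorem 5.2, (ii), a model Frobenioid `ℱ^⊛(†𝒟^⊚)` over the base category
`†𝒟^⊛`"; and (iv) p. 126: "`𝒪^×(A^birat)` … may be naturally identified with the multiplicative group of
non-zero elements of the number field corresponding to `A`".

abc-iut-L5-t1 typed the divisor data as the INTERFACE `GlobalDivisorData G` (`GlobalFrobenioidsModel.lean`,
"TODO-merge: the [FrdI] Ex 6.3 functor"), and `GlobalDivisorData.isFrobenioid_model`
(`GlobalFrobenioidsModelFrobenioid.lean`, abc-iut-w4-d050) proved "`ℱ^⊛(†𝒟^⊚)` is a Frobenioid" MODULO the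
four printed [FrdI] Thm 5.2 hypotheses on `(Φ^⊛, 𝔹)` by name.  This file performs the L1↔L5 MERGE and
DISCHARGES them:

* `absGalGrp F` — `G_F = Gal(F̄/F)` as a profinite group (Mathlib), so that `BaseCat (absGalGrp F) = ℬ(G_F)⁰`;
* `GlobalDivisorData.arith F : GlobalDivisorData (absGalGrp F)` — `Φ^⊛ := Φ ∘ E`, `𝔹 := B ∘ E`,
  `Div := Div_B ∘ E` for abc-iut-L1's [FrdI] Example 6.3 data `(arithDivisorFunctor, unitsFunctor, divNatTrans)`
  over `FinSubextCat F F̄` (`ArithmeticFrobenioidModel.lean`) and the Galois-correspondence EQUIVALENCE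
  `E = galoisSubextOfFinite F : ℬ(G_F)⁰ ⥤ FinSubextCat F F̄` (`FinSubextCatGaloisCorrespondence.lean`): at a
  connected finite `G_F`-set `A`, `Φ^⊛(A)` = the effective arithmetic divisors and `𝔹(A)` = the non-zero elements
  of the number field `F̄^{Stab(a_A)}` "corresponding to `A`";
* `isMonoidOn_comp_of_isEquivalence` — a monoid on `D₂` pulled back along an equivalence `D₁ ⥤ D₂` is a monoid
  on `D₁` ([FrdI] Def 1.1 (ii); FSM-morphisms are preserved by equivalences, abc-iut-found's
  `IsFSM.map_equivalence`);
* `GlobalDivisorData.arith_isMonoidOn_Φ` / `arith_isDivisorial` / `arith_isMonoidOn_B` / `arith_isGroupLike` /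
  `arith_hypotheses` — the [FrdI] Thm 5.2 hypotheses HOLD for the arithmetic model (from L1's `arith_hypotheses`);
* **`GlobalDivisorData.isFrobenioid_arith`** / `isOfIsotropicType_arith` — "by applying [FrdI], Theorem 5.2, (ii),
  a model Frobenioid `ℱ^⊛(†𝒟^⊚)`": `ℱ^⊛(†𝒟^⊚) → F_{Φ^⊛}` IS a Frobenioid of isotropic type, UNCONDITIONALLY;
* `GlobalDivisorData.nonempty_rationalFunctionMonoidStr_arith` — Ex 5.1 (iv)'s "`𝒪^×(A^birat)` … the
  multiplicative group of non-zero elements of the number field corresponding to `A`": the rational-function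
  monoid of the birationalization IS `𝔹 = (A ↦ (F̄^{Stab(a_A)})^×)`, compatibly with divisors (L1's
  [FrdI] Thm 5.2 (ii) "Moreover", `rationalFunctionMonoidIsB_holds`).

With abc-iut-w4-d050's `GlobalFrobenioid.isFrobenioid_equivToElem` / `fcirc_isFrobenioid` / `fmod_isFrobenioid`
(pp. 125–126: `†ℱ^⊛`, `†ℱ^⊚`, `†ℱ^⊛_mod`) every "is a Frobenioid" clause of Example 5.1 (ii)(iii) is thereby a
theorem at the arithmetic model, the [FrdI] Prop 1.6 base-change inputs being discharged in those files.

**Scope of the model (recorded, not glossed over).**  (1) The group.  [FrdI] Example 6.3 is stated for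
`D = B(Gal(F̃/F))⁰`; this file instantiates exactly that, with `F̃ = F̄` and the number field `F` in the role of
print's `F_mod` — i.e. the case in which `π₁(†𝒟^⊛)` IS `G_{F_mod}`.  In Example 5.1 (i) (p. 123) `π₁(†𝒟^⊛)` is the
profinite group "corresponding to `C_{F_mod}`", which acts on `𝕄̄^⊛(†𝒟^⊚) = F̄` THROUGH its quotient
`π₁(†𝒟^⊛) ↠ G_{F_mod}`, and "the corresponding subfield `𝕄̄^⊛(†𝒟^⊚)^A`" is the fixed field of the image of the
open subgroup of `A`; the divisor data over a general `†𝒟^⊛` is the pull-back of the present one along that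
quotient (TODO-merge:abc-iut-L5-t1 `NFBridgeRecon` — the quotient map is its `actionKer`).  (2) "Stack-theoretic"
(Remark 3.1.5, p. 65): print's `Φ^⊛(†𝒟^⊚)(A)` is the monoid of arithmetic divisors on the STACK `S_{mod,L}`
("the easily verified 'stack-theoretic version' of the construction of [FrdI], Example 6.3"), which "upon passing
to either the perfection or the realification … become[s] naturally isomorphic to the non-stack-theoretic
version[s] [i.e., of [FrdI], Example 6.3, as stated]" (p. 66); abc-iut-L1 types [FrdI] Example 6.3 AS STATED
(`EffArithDivisor`), and so does this model.  No new Prop fact; no statement of the paper is strengthened; no side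
is taken on [IUTchIII] Cor. 3.12.
-/

noncomputable section

namespace Literature.IUT.HodgeTheaters

open CategoryTheory Opposite Literature.AlgebraicGeometry.Frobenioids
open Literature.AlgebraicGeometry.Frobenioids.QuasiTemperoid

universe w v₁ v₂ u₁ u₂

/-! ### Monoids on a category pull back along equivalences ([FrdI] Def 1.1 (ii)) -/

/-- A monoid `Φ` on `D₂` ([FrdI] Def 1.1 (ii)) composed with an EQUIVALENCE `E : D₁ ⥤ D₂` is a monoid on `D₁`:
pull-backs along `α` are the pull-backs along `E(α)` (characteristically injective), and `E` carries
FSM-morphisms to FSM-morphisms (abc-iut-found's `IsFSM.map_equivalence`), which pull back to bijections.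
([IUTchI] Ex 5.1 (ii) p.125; [FrdI] Def 1.1 (ii)) [claim: Mochizuki2012, status: disputed] -/
theorem isMonoidOn_comp_of_isEquivalence {D₁ : Type u₁} [Category.{v₁} D₁] {D₂ : Type u₂} [Category.{v₂} D₂]
    (E : D₁ ⥤ D₂) [E.IsEquivalence] {Φ : D₂ᵒᵖ ⥤ CommMonCat.{w}} (hΦ : IsMonoidOn Φ) :
    IsMonoidOn (E.op ⋙ Φ) where
  isCharInjective α := hΦ.isCharInjective (E.map α)
  bijective_of_isFSM α hα := hΦ.bijective_of_isFSM (E.map α) (hα.map_equivalence E.asEquivalence)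

/-- An objectwise property of a monoid on `D₂` is inherited by its composite with any functor `D₁ ⥤ D₂`.
([IUTchI] Ex 5.1 (ii) p.125; [FrdI] Def 1.1 (ii)) [claim: Mochizuki2012, status: disputed] -/
theorem objectwise_comp {D₁ : Type u₁} [Category.{v₁} D₁] {D₂ : Type u₂} [Category.{v₂} D₂] (E : D₁ ⥤ D₂)
    {P : ∀ (M : Type w) [CommMonoid M], Prop} {Φ : D₂ᵒᵖ ⥤ CommMonCat.{w}} (hΦ : Objectwise P Φ) :
    Objectwise P (E.op ⋙ Φ) :=
  fun A => hΦ (E.obj A)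

/-! ### `G_F` and `†𝒟^⊛ = ℬ(G_F)⁰` for a number field `F` -/

variable (F : Type) [Field F] [NumberField F]

/-- `F̄/F` is Galois (`F` has characteristic zero). ([IUTchI] Ex 5.1 (i) p.123) [claim: Mochizuki2012, status: disputed] -/
theorem isGalois_fbar : IsGalois F (Fbar F) := {}

/-- `G_F = Gal(F̄/F)` as a PROFINITE group (Mathlib's Krull topology; compact since `F̄/F` is Galois), so that
L5's `BaseCat (absGalGrp F)` is `ℬ(G_F)⁰ = ConnectedPart (BCat (GalFbar F))` on the nose.
([IUTchI] Ex 5.1 (i) p.123) [claim: Mochizuki2012, status: disputed] -/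
abbrev absGalGrp : ProfiniteGrp.{0} :=
  haveI : IsGalois F (Fbar F) := isGalois_fbar F
  ProfiniteGrp.of (GalFbar F)

/-- `†𝒟^⊛ = ℬ(G_F)⁰` is literally the source of the Galois-correspondence equivalence.
([IUTchI] Ex 5.1 (i) p.123) [claim: Mochizuki2012, status: disputed] -/
theorem baseCat_absGalGrp : BaseCat (absGalGrp F) = ConnectedPart (BCat (GalFbar F)) := rfl

/-! ### The divisor data of Example 5.1 (ii) at the arithmetic model -/

namespace GlobalDivisorData

/-- **[IUTchI] Ex 5.1 (ii) at the ARITHMETIC MODEL**: the divisor data `(Φ^⊛(†𝒟^⊚), 𝔹, 𝕄^⊛(†𝒟^⊚)^A → Φ^⊛(A)^gp)`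
on `†𝒟^⊛ = ℬ(G_F)⁰` given by [FrdI] Example 6.3 — abc-iut-L1's `arithDivisorFunctor` (effective arithmetic
divisors), `unitsFunctor` (`L ↦ L^×`) and `divNatTrans` (`f ↦ div f`) over `FinSubextCat F F̄` — transported
along the Galois correspondence `galoisSubextOfFinite F : ℬ(G_F)⁰ ⥤ FinSubextCat F F̄`
(`A ↦ Spec F̄^{Stab(a_A)}`, "the number field corresponding to `A`").
([IUTchI] Ex 5.1 (ii) p.125) [claim: Mochizuki2012, status: disputed] -/
def arith : GlobalDivisorData (absGalGrp F) where
  Φ := (galoisSubextOfFinite F).op ⋙ arithDivisorFunctor F (Fbar F)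
  B := (galoisSubextOfFinite F).op ⋙ unitsFunctor F (Fbar F)
  div := Functor.whiskerLeft (galoisSubextOfFinite F).op (divNatTrans F (Fbar F))

/-- `Φ^⊛(A)` at the model is the monoid of effective arithmetic divisors of "the number field corresponding to
`A`" (`((galoisSubextOfFinite F).obj A).L = F̄^{Stab(a_A)}`, `arith_field_eq`).
([IUTchI] Ex 5.1 (ii) p.125) [claim: Mochizuki2012, status: disputed] -/
theorem arith_Φ_obj (A : BaseCat (absGalGrp F)) :
    ((arith F).Φ.obj (op A) : Type) = Multiplicative (EffArithDivisor ((galoisSubextOfFinite F).obj A).L) := rfl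

/-- … namely of the number field `F̄^{Stab(a_A)}` (the base point `a_A` of `A` viewed in `B^temp(G_F)`).
([IUTchI] Ex 5.1 (ii) p.125) [claim: Mochizuki2012, status: disputed] -/
theorem arith_field_eq (A : BaseCat (absGalGrp F)) :
    ((galoisSubextOfFinite F).obj A).L = fixFld F ((BCat.connectedToBTemp (GalFbar F)).obj A) := rfl

/-- `𝔹(A)` at the model is the unit group of the number field `F̄^{Stab(a_A)}` "corresponding to `A`".
([IUTchI] Ex 5.1 (ii) p.125) [claim: Mochizuki2012, status: disputed] -/
theorem arith_B_obj (A : BaseCat (absGalGrp F)) :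
    ((arith F).B.obj (op A) : Type) = (↥(fixFld F ((BCat.connectedToBTemp (GalFbar F)).obj A)))ˣ := rfl

/-- **[FrdI] Thm 5.2 hypothesis (1) DISCHARGED at the model: `Φ^⊛` is a monoid on `†𝒟^⊛`** (L1's
`arithDivisorFunctor_isMonoidOn` for `F̄/F` Galois, pulled back along the Galois-correspondence equivalence).
([IUTchI] Ex 5.1 (ii) p.125) [claim: Mochizuki2012, status: disputed] -/
theorem arith_isMonoidOn_Φ : IsMonoidOn (arith F).Φ := by
  haveI : IsGalois F (Fbar F) := isGalois_fbar F
  haveI := isEquivalence_galoisSubextOfFinite F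
  exact isMonoidOn_comp_of_isEquivalence (galoisSubextOfFinite F) (arithDivisorFunctor_isMonoidOn F (Fbar F))

/-- **[FrdI] Thm 5.2 hypothesis (2) DISCHARGED at the model: `Φ^⊛` is divisorial** (objectwise: L1's
`EffArithDivisor.isDivisorial`). ([IUTchI] Ex 5.1 (ii) p.125) [claim: Mochizuki2012, status: disputed] -/
theorem arith_isDivisorial : Objectwise (fun M _ => IsDivisorial M) (arith F).Φ :=
  objectwise_comp (galoisSubextOfFinite F) (arithDivisorFunctor_isDivisorial F (Fbar F))

/-- **[FrdI] Thm 5.2 hypothesis (3) DISCHARGED at the model: `𝔹` is a monoid on `†𝒟^⊛`** (L1's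
`unitsFunctor_isMonoidOn`, pulled back along the equivalence).
([IUTchI] Ex 5.1 (ii) p.125) [claim: Mochizuki2012, status: disputed] -/
theorem arith_isMonoidOn_B : IsMonoidOn (arith F).B := by
  haveI : IsGalois F (Fbar F) := isGalois_fbar F
  haveI := isEquivalence_galoisSubextOfFinite F
  exact isMonoidOn_comp_of_isEquivalence (galoisSubextOfFinite F) (unitsFunctor_isMonoidOn F (Fbar F))

/-- **[FrdI] Thm 5.2 hypothesis (4) DISCHARGED at the model: `𝔹` is group-like** (objectwise: L1's
`unitsFunctor_isGroupLike`). ([IUTchI] Ex 5.1 (ii) p.125) [claim: Mochizuki2012, status: disputed] -/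
theorem arith_isGroupLike : Objectwise (fun M _ => IsGroupLike M) (arith F).B :=
  objectwise_comp (galoisSubextOfFinite F) (unitsFunctor_isGroupLike F (Fbar F))

/-- ALL standing hypotheses of [FrdI] Thm 5.2 for `(Φ^⊛, 𝔹)` over `†𝒟^⊛ = ℬ(G_F)⁰`, in abc-iut-L1-t2's packaging
(`ModelFrobenioid.Hypotheses`): the four monoid clauses above together with `†𝒟^⊛` connected and totally
epimorphic (`isGraphConnected_baseCat`, `isTotallyEpimorphic_baseCat`).
([IUTchI] Ex 5.1 (ii) p.125) [claim: Mochizuki2012, status: disputed] -/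
theorem arith_hypotheses : ModelFrobenioid.Hypotheses (arith F).Φ (arith F).B where
  isMonoidOn := arith_isMonoidOn_Φ F
  isDivisorial := arith_isDivisorial F
  isMonoidOn_rat := arith_isMonoidOn_B F
  isGroupLike_rat := arith_isGroupLike F
  isGraphConnected := isGraphConnected_baseCat (absGalGrp F)
  isTotallyEpimorphic := isTotallyEpimorphic_baseCat (absGalGrp F)

/-- **[IUTchI] Ex 5.1 (ii), "by applying [FrdI], Theorem 5.2, (ii), a model Frobenioid `ℱ^⊛(†𝒟^⊚)` over the
base category `†𝒟^⊛`" — UNCONDITIONAL at the arithmetic model**: the structure functor `ℱ^⊛(†𝒟^⊚) → F_{Φ^⊛}`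
of the model Frobenioid of `GlobalDivisorData.arith F` IS a Frobenioid (abc-iut-w4-d050's `isFrobenioid_model`
with all four [FrdI] Thm 5.2 hypotheses discharged above).
([IUTchI] Ex 5.1 (ii) p.125) [claim: Mochizuki2012, status: disputed] -/
theorem isFrobenioid_arith :
    PreFrobenioid.IsFrobenioid (ModelFrobenioid.toElem (arith F).Φ (arith F).B (arith F).div) :=
  (arith F).isFrobenioid_model (arith_isMonoidOn_Φ F) (arith_isDivisorial F) (arith_isMonoidOn_B F)
    (arith_isGroupLike F)

/-- … and it is of ISOTROPIC type ([FrdI] Thm 5.2 (ii)), unconditionally.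
([IUTchI] Ex 5.1 (ii) p.125) [claim: Mochizuki2012, status: disputed] -/
theorem isOfIsotropicType_arith :
    PreFrobenioid.IsOfIsotropicType (ModelFrobenioid.toElem (arith F).Φ (arith F).B (arith F).div) :=
  (arith F).isOfIsotropicType_model (arith_isGroupLike F)

/-- **[IUTchI] Ex 5.1 (iv), "`𝒪^×(A^birat)` … may be naturally identified with the multiplicative group of
non-zero elements of the number field corresponding to `A`" — at the arithmetic model**: the rational-function
monoid `𝒪^×(−)` of the birationalization of `ℱ^⊛(†𝒟^⊚)` IS `𝔹 = (A ↦ (F̄^{Stab(a_A)})^×)`, naturally and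
compatibly with the divisor maps ([FrdI] Thm 5.2 (ii) "Moreover", abc-iut-L1's `rationalFunctionMonoidIsB_holds`,
applied with the discharged hypotheses). ([IUTchI] Ex 5.1 (iv) p.126) [claim: Mochizuki2012, status: disputed] -/
theorem nonempty_rationalFunctionMonoidStr_arith :
    Nonempty (PreFrobenioid.RationalFunctionMonoidStr
      (ModelFrobenioid.toElem (arith F).Φ (arith F).B (arith F).div) (isFrobenioid_arith F)
      (arith F).B (arith F).div) :=
  ModelFrobenioid.rationalFunctionMonoidIsB_holds (arith F).Φ (arith F).B (arith F).div (arith_hypotheses F)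
    (isFrobenioid_arith F)

end GlobalDivisorData

end Literature.IUT.HodgeTheaters

end
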